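import Summits.HubbardSuperconductivity.HubbardSuperconductivity.Theorems.AnisotropyChordTransferFibre3BetaFreeTargets

/-!
# Route `AnisotropyChord` / H0 rotor rung: PORT PartN32 — (KT-2b) AT LEVEL 1: THE PAIR-SPLIT OBJECT cs2, ITS REAL-SPACE NAMED BOUND, THE N-TERM, THE CLOSED-FORM DenMinRest

Verbatim port (modulo this header, the port comment and lint options) of the theory seat's statement file
`hubbard-h0-rotor-theory-1/cycle21/lean/PartN32.lean` (sha16 `8406e5c596c7d7e4`; theory seat `hubbard-h0-rotor-theory-1` g21).
Statements only (targets typed by the theory seat; no proofs claimed here beyond what the theory file itself proves).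
Prover seat `hubbard-h0-rotor-p1` g22; helper for stmt-HubbardSuperconductivity-19089 (`--supports`).

Theory seat's own summary of the file:

# PartN32 — (KT-2b) at Level 1: the pair-split Cauchy–Schwarz object `cs2`, its REAL-SPACE NAMED BOUND,
the `N`-term, and the closed-form `DenMinRest` (theory seat hubbard-h0-rotor-theory-1, generation 21; memo
ROTOR-THEORY-21 §304–§306).  Statements only (Props + defs); imports the landed port of PartN31
(`…Fibre3BetaFreeTargets`, p729729) for `IsGroundTwoMagnon`, `resid`, `polePart`, `lowNormPart`, `DenMinRest`.

THE CHAIN for `‖R′‖²` (R′ = off-`D` residual of the `K₁` trial state `vΠ⁰` at `E = ε₁ + T⁺`):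
  `R′ = E₁₂ + E₁₃ + E₂₃ + v·C0′` (exact pair split of MIXED, memo 20 §289),  `‖E₁₂‖ = ‖E₁₃‖ = ‖E₂₃‖`,
  `|E₁₂(a,b)|² ≤ ½(d₊(a)²|A₊(a,b)|² + d₋(a)²|A₋(a,b)|²)`  ⇒  `‖R′‖ ≤ 3·√cs2 + ‖v C0′‖`, `‖vC0′‖² ≤ 9‖C0′‖²`;
  THEOREM (KT-2b-cs2): `cs2 ≤ 4ε₁Q₀X + ε₁R̄(Γ_M + 2f_nn²M²) + 2ε₁√(4Q₀X·Γ_M R̄)` with the NAMED real-space sums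
  `R̄ = Σ_{a∉{0,x̂}} (∇ₓs)²`, `X = Σ_a R(a)(1 − cos θ(aₓ−1))`, `Q₀ = Σ f⁴`, `Γ_M = 2M²(R̄ + 2f_nn²)`, `|f| ≤ M`
  (sharp to 1.33 (L=8) … 1.055 (L=64), uniformly in Δ; all of R̄, X are one-loop sums of `t = FT[s²]`, `tₓ = FT[s·s(·−x̂)]`).
  LEMMA (DenMinRest, closed form): off the poles and the low shell `Σ_i ε(k_i) ≥ (5 + 2cos θ)ε₁`, so
  `den ≥ (4+2cos θ)ε₁ − T⁺ ≥ (2 + cos θ)(2ε₁ − T⁺)` for `T⁺ ≥ 0`.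
-/

-- Port of theory seat `hubbard-h0-rotor-theory-1` cycle21/lean/PartN32.lean (sha16 8406e5c596c7d7e4) verbatim modulo this header,
-- lint options and lint fixes; prover seat `hubbard-h0-rotor-p1` g22, `--supports stmt-HubbardSuperconductivity-19089`.

set_option linter.dupNamespace false
noncomputable section

open scoped BigOperators
open Complex

namespace Summit.HubbardSuperconductivity.HubbardSuperconductivity.Theorems.AnisotropyChord.Transfer.Fibre3

variable (L : ℕ) [NeZero L]

/-! ## Real-space objects of the pair function -/

/-- the small part `s` of the pair function: `s(0) = 1 − Δ f_nn`, `s(r) = 1 − f(r)` for `r ≠ 0`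
(`f = 1 − h`, `s = h − Δ f_nn δ₀`; `ŝ(k) = c_s/(2ε(k) − λ₂)` for `k ≠ 0` by `TwoMagnonFourier`). -/
def sfun (Δ : ℝ) (f : Tor L → ℝ) : Tor L → ℝ := fun r => if r = 0 then 1 - Δ * f (K1 L) else 1 - f r

/-- backward lattice derivative along `x̂ = K1`: `(∇ₓ g)(a) = g(a) − g(a − x̂)`. -/
def gradx (g : Tor L → ℝ) (a : Tor L) : ℝ := g a - g (a - K1 L)

/-- the regular weight `R(a) = (∇ₓ s(a))² = d₊(a)²` for `a ∉ {0, x̂}`, set to `0` on the contact pair `{0, x̂}`. -/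
def Rwt (Δ : ℝ) (f : Tor L → ℝ) (a : Tor L) : ℝ :=
  if a = 0 ∨ a = K1 L then 0 else gradx L (sfun L Δ f) a ^ 2

/-- `R̄ = Σ_a R(a) = ‖∇ₓ f‖² − 2 f_nn²` (one-loop: `2(t(0) − tₓ(0)) − 2f_nn²(1−Δ)²`). -/
def Rbar (Δ : ℝ) (f : Tor L → ℝ) : ℝ := ∑ a : Tor L, Rwt L Δ f a

/-- the `K₁` phase-defect moment `X = Σ_a R(a)(1 − cos(θ(aₓ − 1))) = R̄ − Re(e^{iθ} R̂(K₁))`. -/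
def Xmom (Δ : ℝ) (f : Tor L → ℝ) : ℝ :=
  ∑ a : Tor L, Rwt L Δ f a * (1 - Real.cos (2 * Real.pi * ((a.1.val : ℝ) - 1) / L))

/-- `Q₀ = Σ_r f(r)⁴` (≥ every correlation `Q(a) = Σ_b f(b−a)² f(b)²`, by Cauchy–Schwarz). -/
def Q0 (f : Tor L → ℝ) : ℝ := ∑ r : Tor L, f r ^ 4

/-- `Γ_M = 2 M² ‖∇ₓ f‖² = 2 M² (R̄ + 2 f_nn²)`. -/
def GammaM (Δ : ℝ) (f : Tor L → ℝ) (M : ℝ) : ℝ := 2 * M ^ 2 * (Rbar L Δ f + 2 * f (K1 L) ^ 2)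

/-! ## The pair-split Cauchy–Schwarz object `cs2` (memo 20 §292, memo 21 §304(a)) -/

/-- `w₊ = 1 − e^{iθ}`. -/
def wplus : ℂ := 1 - phase L (K1 L) (K1 L)

/-- `w₋ = 1 − e^{−iθ}`. -/
def wminus : ℂ := 1 - phase L (K1 L) (-(K1 L))

/-- `A₊(a,b) = w₊·f(c)(f(b)+f(b−x̂))/2 + w₋ e^{iθaₓ}·f(b)(f(c)+f(c+x̂))/2`, `c = b − a`. -/
def Aplus (f : Tor L → ℝ) (c : Cfg L) : ℂ :=
  wplus L * ((f (c.2 - c.1) * (f c.2 + f (c.2 - K1 L)) / 2 : ℝ) : ℂ)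
    + wminus L * phase L (K1 L) c.1 * ((f c.2 * (f (c.2 - c.1) + f (c.2 - c.1 + K1 L)) / 2 : ℝ) : ℂ)

/-- `A₋(a,b) = w₋·f(c)(f(b)+f(b+x̂))/2 + w₊ e^{iθaₓ}·f(b)(f(c)+f(c−x̂))/2` (the x-mirror of `A₊`). -/
def Aminus (f : Tor L → ℝ) (c : Cfg L) : ℂ :=
  wminus L * ((f (c.2 - c.1) * (f c.2 + f (c.2 + K1 L)) / 2 : ℝ) : ℂ)
    + wplus L * phase L (K1 L) c.1 * ((f c.2 * (f (c.2 - c.1) + f (c.2 - c.1 - K1 L)) / 2 : ℝ) : ℂ)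

/-- `cs2 = Σ_{(a,b)∉D} ½(d₊(a)²|A₊|² + d₋(a)²|A₋|²)`, `d±(a) = f(a) − f(a ∓ x̂)`; `E₁₂ = −½(d₊A₊ + d₋A₋)`. -/
def cs2 (f : Tor L → ℝ) : ℝ :=
  ∑ c : Cfg L, if InD L c then 0 else
    ((f c.1 - f (c.1 - K1 L)) ^ 2 * Complex.normSq (Aplus L f c)
      + (f c.1 - f (c.1 + K1 L)) ^ 2 * Complex.normSq (Aminus L f c)) / 2

/-- the `K = 0` off-`D` residual of the product state at `T⁺`: `C0′ = 1_{Dᶜ}(H⁰ − T⁺)Π⁰`. -/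
def C0p (Δ : ℝ) (f : Tor L → ℝ) : Cfg L → ℂ := fun c =>
  if InD L c then 0 else Happly L 0 Δ (prodState L f) c - ((Tplus L Δ f : ℝ) : ℂ) * prodState L f c

/-- `‖N‖² = ‖v·C0′‖²`. -/
def nNterm (Δ : ℝ) (f : Tor L → ℝ) : ℝ := ∑ c : Cfg L, Complex.normSq (vfun L c * C0p L Δ f c)

/-- `‖C0′‖²`. -/
def nC0p (Δ : ℝ) (f : Tor L → ℝ) : ℝ := ∑ c : Cfg L, Complex.normSq (C0p L Δ f c)

/-! ## The statements -/

/-- PAIR-SPLIT CS (support; algebra of memo 20 §289/§292): `‖R′‖ ≤ 3√cs2 + ‖N‖`. -/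
def PairSplitCS (Δ : ℝ) : Prop :=
  ∀ lam2 : ℝ, ∀ f : Tor L → ℝ, IsGroundTwoMagnon L Δ lam2 f → (∀ r : Tor L, f (-r.1, r.2) = f r) →
    (ip L (resid L Δ f) (resid L Δ f)).re ≤ (3 * Real.sqrt (cs2 L f) + Real.sqrt (nNterm L Δ f)) ^ 2

/-- `‖N‖² ≤ 9 ‖C0′‖²` (support; `|v| ≤ 3`). -/
def NTermBound (Δ : ℝ) : Prop := ∀ f : Tor L → ℝ, nNterm L Δ f ≤ 9 * nC0p L Δ f

/-- ★ THEOREM (KT-2b-cs2), Level 1 (memo 21 §304(c); proved at memo standard, verified numerically `L = 8…64`):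
for an x-mirror-symmetric two-magnon profile with `|f| ≤ M`,
`cs2 ≤ 4ε₁Q₀X + ε₁R̄(Γ_M + 2 f_nn² M²) + 2ε₁ √(4Q₀X · Γ_M R̄)`. -/
def Cs2RealSpaceBound (Δ : ℝ) : Prop :=
  ∀ lam2 M : ℝ, ∀ f : Tor L → ℝ, IsTwoMagnon L Δ lam2 f → (∀ r : Tor L, f (-r.1, r.2) = f r) →
    (∀ r : Tor L, |f r| ≤ M) →
      cs2 L f ≤ 4 * eps1 L * Q0 L f * Xmom L Δ f
        + eps1 L * Rbar L Δ f * (GammaM L Δ f M + 2 * f (K1 L) ^ 2 * M ^ 2)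
        + 2 * eps1 L * Real.sqrt (4 * Q0 L f * Xmom L Δ f * (GammaM L Δ f M * Rbar L Δ f))

/-- LEMMA (DenMinRest, lattice form; memo 21 §306, elementary finite case analysis + `1 − cos 3θ = (1−c)(1+2c)²`):
off the poles and the low shell the free three-magnon energy in the `K₁` fibre is `≥ (5 + 2cos θ) ε₁` (`L ≥ 8`). -/
def DenMinRestLattice : Prop :=
  8 ≤ L → ∀ k₂ k₃ : Tor L, IsPoleK1 L k₂ k₃ = false → ¬ IsLowShell L k₂ k₃ →
    (5 + 2 * Real.cos (2 * Real.pi / L)) * eps1 L ≤ epsT L (K1 L - k₂ - k₃) + epsT L k₂ + epsT L k₃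

/-- its consequence in the currency of PartN31: `DenMinRest Δ (2 + cos θ)` whenever `T⁺ ≥ 0`
(`den = Σε − ε₁ − T⁺ ≥ (4+2c)ε₁ − T⁺ ≥ (2+c)(2ε₁ − T⁺)`). -/
def DenMinRestClosed (Δ : ℝ) : Prop :=
  8 ≤ L → ∀ lam2 : ℝ, ∀ f : Tor L → ℝ, IsGroundTwoMagnon L Δ lam2 f → 0 ≤ Tplus L Δ f → ∀ k₂ k₃ : Tor L,
    IsPoleK1 L k₂ k₃ = false → ¬ IsLowShell L k₂ k₃ →
      (2 + Real.cos (2 * Real.pi / L)) * (2 * eps1 L - Tplus L Δ f) ≤ den L (Tplus L Δ f) k₂ k₃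

/-- the elementary implication (pure arithmetic once `den` is unfolded). -/
def DenMinRestClosed_of_lattice_stmt : Prop := DenMinRestLattice L → ∀ Δ : ℝ, DenMinRestClosed L Δ

/-- (KT-2b″) FROM THE PIECES (support: how `OffPoleTailAbs` of PartN31 is reached): with `P`, `lowN` the pole and
low-shell parts of `‖R′‖²`, `‖R′‖² − P − lowN ≤ (3√cs2 + 3√nC0′)² − P − lowN`, and the right side is a closed
expression in named one-loop / two-loop sums (`cs2` via `Cs2RealSpaceBound`; `P`, `lowN` exact one-loop, memo 21 §299). -/
def OffPoleTailFromPieces (Δ : ℝ) : Prop :=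
  ∀ lam2 : ℝ, ∀ f : Tor L → ℝ, IsGroundTwoMagnon L Δ lam2 f → (∀ r : Tor L, f (-r.1, r.2) = f r) →
    (ip L (resid L Δ f) (resid L Δ f)).re - polePart L Δ f - lowNormPart L Δ f
      ≤ (3 * Real.sqrt (cs2 L f) + 3 * Real.sqrt (nC0p L Δ f)) ^ 2 - polePart L Δ f - lowNormPart L Δ f

end Summit.HubbardSuperconductivity.HubbardSuperconductivity.Theorems.AnisotropyChord.Transfer.Fibre3

end
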